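import Literature.Computability.QuantumComplexity.UncomputeBranches
import Literature.Computability.QuantumComplexity.LightCone
import HarnessLib

/-!
# Local basis maps commute with gates off their support

Topic `Literature/Computability/QuantumComplexity`; sequel of `UncomputeBranches.lean` (`IsBasisMap M κ`:
`M |z⟩ = |κ z⟩`, e.g. a compiled reversible classical stage; `IsBasisMap.mulVec_restBlockState_of_comm`)
and `LightCone.lean` (`SupportedOn T M`: `M` commutes with every gate placed off `T`;
`SupportedOn.comm_toMatrix`). A classical reversible stage of a quantum machine reads and writes only
some wires; this file turns that locality into the commutation vocabulary of the light cone: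

* `IsBasisMap.mul_placeGate_comm` — a basis map whose relabelling commutes with writing the block `E`
  commutes, as an operator, with every gate placed on `E` (Nielsen–Chuang 2010, eq. (2.45));
* **`IsBasisMap.supportedOn_of_local`** — if `κ` fixes the wires off `T` and its values on `T` depend
  only on the content of `T`, then `M` is supported on `T`;
* `SupportedOn.comm_toMatrix_gates` — an operator supported on `T` commutes with every gate list acting
  off `T`.

In Regev's one-copy sampler (J. ACM 56 (2009), art. 34, Lemma 3.14) the classical stages (instance
parsing, table erasure, output coding) read and write the input zone and the registers of the used
coordinate slots only, so the quantum stages acting on unused slots commute past them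
(`IdleGatesInvariance.lean` then deletes those).

Everything is proved; no definition, no named fact is introduced.

## References

* M. A. Nielsen, I. L. Chuang, *Quantum Computation and Quantum Information*, CUP 2010, §2.1.7
  eq. (2.45), §3.2.5, §4.2 [NielsenChuang2010].
* E. Bernstein, U. Vazirani, *Quantum complexity theory*, SIAM J. Comput. 26 (1997) 1411–1473, §8.2
  [BernsteinVazirani1997].
* O. Regev, *On lattices, learning with errors, random linear codes, and cryptography*, J. ACM 56
  (2009), art. 34, Lemma 3.14 (proof) [Regev2009].
-/

noncomputable section

open Matrix Finset

namespace Literature.Computability.QuantumComplexity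

open Cryptography LightCone

variable {W b : ℕ} {M : Matrix (QReg W) (QReg W) ℂ} {κ : QReg W → QReg W}

/-- **A basis map commuting with writing the block commutes with every gate on the block.**
[cite: NielsenChuang2010, §2.1.7 eq. (2.45), §3.2.5] -/
theorem IsBasisMap.mul_placeGate_comm (E : Fin b ↪ Fin W) (h : IsBasisMap M κ)
    (hκ : ∀ (f : QReg b) (c : QReg W), κ (Function.extend E f c) = Function.extend E f (κ c))
    (U : Matrix (QReg b) (QReg b) ℂ) : M * placeGate E U = placeGate E U * M := by
  -- matrix entries are amplitudes of the images of basis states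
  have key : ∀ (A : Matrix (QReg W) (QReg W) ℂ) (x y : QReg W), A x y = (A *ᵥ basisState y) x := by
    intro A x y
    simp [Matrix.mulVec, dotProduct, basisState_apply]
  ext x y
  rw [key (M * placeGate E U) x y, key (placeGate E U * M) x y, ← Matrix.mulVec_mulVec,
    ← Matrix.mulVec_mulVec, basisState_eq_restBlockState E y, placeGate_mulVec_restBlockState,
    h.mulVec_restBlockState_of_comm E hκ, h.mulVec_restBlockState_of_comm E hκ, placeGate_mulVec_restBlockState]

/-- **Locality gives support**: if the relabelling `κ` of a basis map fixes every wire off `T` and its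
values on `T` depend only on the content of `T`, the basis map is supported on `T` (commutes with every
gate placed off `T`). [cite: NielsenChuang2010, §2.1.7 eq. (2.45), §4.2] -/
theorem IsBasisMap.supportedOn_of_local {T : Finset (Fin W)} (h : IsBasisMap M κ)
    (hoff : ∀ (z : QReg W) (w : Fin W), w ∉ T → κ z w = z w)
    (hon : ∀ z z' : QReg W, (∀ w ∈ T, z w = z' w) → ∀ w ∈ T, κ z w = κ z' w) :
    SupportedOn T M := by
  intro b E U hE
  refine h.mul_placeGate_comm E (fun f c => ?_) U
  funext w
  by_cases hw : w ∈ Set.range E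
  · obtain ⟨i, rfl⟩ := hw
    rw [E.injective.extend_apply, hoff _ _ (hE i), E.injective.extend_apply]
  · rw [extend_apply_of_not_mem E f (κ c) hw]
    by_cases hT : w ∈ T
    · exact hon _ _ (fun w' hw' => extend_apply_of_not_mem E f c fun ⟨i, hi⟩ => hE i (hi ▸ hw')) w hT
    · rw [hoff _ _ hT, extend_apply_of_not_mem E f c hw, hoff _ _ hT]

/-- **An operator supported on `T` commutes with every gate list acting off `T`.**
[cite: NielsenChuang2010, §2.1.7 eq. (2.45), §4.2] -/
theorem LightCone.SupportedOn.comm_toMatrix_gates {G : QGateSet} (A : Language Bool) {T : Finset (Fin W)}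
    {N : Matrix (QReg W) (QReg W) ℂ} (hN : SupportedOn T N) :
    ∀ {gs : List (QGate G W)}, (∀ g ∈ gs, Disjoint g.wires T) →
      N * (⟨gs⟩ : QCircuit G W).toMatrix A = (⟨gs⟩ : QCircuit G W).toMatrix A * N
  | [], _ => by rw [QCircuit.toMatrix_nil, Matrix.mul_one, Matrix.one_mul]
  | g :: gs, h => by
    rw [QCircuit.toMatrix_cons, ← Matrix.mul_assoc,
      hN.comm_toMatrix_gates A (fun g' hg' => h g' (List.mem_cons_of_mem g hg')), Matrix.mul_assoc,
      hN.comm_toMatrix A (h g List.mem_cons_self), Matrix.mul_assoc]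

/-- **A local classical stage lets the idle gates pass**: for a basis map `M` local to `T` and a gate list
`J` acting off `T`, `M (J ψ) = J (M ψ)`. [cite: NielsenChuang2010, §2.1.7 eq. (2.45)] [cite: Regev2009, Lemma 3.14 (proof)] -/
theorem IsBasisMap.mulVec_toMatrix_mulVec_comm {G : QGateSet} (A : Language Bool) {T : Finset (Fin W)}
    (h : IsBasisMap M κ) (hoff : ∀ (z : QReg W) (w : Fin W), w ∉ T → κ z w = z w)
    (hon : ∀ z z' : QReg W, (∀ w ∈ T, z w = z' w) → ∀ w ∈ T, κ z w = κ z' w)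
    {gs : List (QGate G W)} (hJ : ∀ g ∈ gs, Disjoint g.wires T) (ψ : QReg W → ℂ) :
    M *ᵥ ((⟨gs⟩ : QCircuit G W).toMatrix A *ᵥ ψ) = (⟨gs⟩ : QCircuit G W).toMatrix A *ᵥ (M *ᵥ ψ) := by
  rw [Matrix.mulVec_mulVec, Matrix.mulVec_mulVec, (h.supportedOn_of_local hoff hon).comm_toMatrix_gates A hJ]

end Literature.Computability.QuantumComplexity

end
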